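import Literature.MathematicalPhysics.QuantumLattice.HubbardFermiSurfaceSmearing
import Summits.HubbardSuperconductivity.HubbardLadder.HubbardDopedMomentRows
import HarnessLib

/-!
# Doped `4 × 4` Hubbard torus, `N = 14`, `U = 8`: the `U′ = 16` lever — parametric rows (R2, device D25, part 2)

HONEST FRAMING: ladder R1–R4 with certified numbers; no claim on H/H₀. WEAK / PARAMETRIC rows (ED-able
cluster; no number is claimed: every row is parametric in a real `E₁₆` under the hypothesis
`E₁₆ ≤ E_14(U′ = 16)`).

Companion of `HubbardDopedU12LeverRows` (the `U′ = 12` lever, LEAN FILING REQUEST #143). The cell lead AMENDED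
the named certificate (LEAD LINE (Q), 2026-08-20T19:10:46Z) to `engA-secrows1-N14.EU16` = ONE certsdp energy
LOWER bound `E₁₆ ≤ E_14(t = 1, U′ = 16, t′ = 0)` on the `4 × 4` torus at `N = 14`, because the expected
positive double-occupancy edge is safer at `U′ = 16`. Device (Koma–Tasaki supergradient at the `U = 8` ground
state `ψ`, step `U′ - 8 = 8`): `E_14(16) - E_14(8) ≤ 8⟨ψ, D ψ⟩` (`DoubleOccupancy.groundEnergyAt_sub_le_mul_doubleOcc`)
with the LANDED Rayleigh upper node `u₈ := -815606355579/2³⁶ ≈ -11.8686` (`torusUpper_mbbootE2_4x4_U8_N14`,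
`E_14(8) ≤ u₈`) gives, for every real `E₁₆ ≤ E_14(16)`:
* `d ≥ (E₁₆ - u₈)/128` (`doubleOcc_four_N14_U8_ge_of_lower16`, claim form `…_ge_of_claim_of_lower16`);
* `k ≤ (2u₈ - E₁₆)/16` (`K = E_14(8) - 8⟨D⟩ ≤ u₈ - (E₁₆ - u₈)`; `kineticPerSite_four_N14_U8_le_of_lower16`);
* bond-averaged hopping `∈ [-(2u₈ - E₁₆)/128, 3/16]` (`bondAvg_four_N14_U8_mem_Icc_of_lower16`);
* `m_loc ≤ 7/8 - (E₁₆ - u₈)/64` (`localMoment_four_N14_U8_le_of_lower16`);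
* Fermi-surface smearing `W_0 ≤ 2u₈ - E₁₆ + 24` and the occupation rows `dev ≤ W/2`, `nInside ≥ 14 - W/2`,
  `h_Γ + n_Q ≤ W/4` (`smearing_four_N14_U8_le_of_lower16`, `occupationRows_four_N14_U8_of_lower16`; D24 kernel
  `FermiSmearing`).
When bounds types the node `X : Prop := (c : ℝ) ≤ groundEnergyAt (fermionTorusGraph 2 4) 1 16 14`, its `_ge_of_claim`
lemma is the argument `hL` and the numeric rows follow by `norm_num`. ILLUSTRATION ONLY (HYPOTHETICAL threshold
`-10`, inside pseudo's pre-registered NON-RIGOROUS band `[-10.6, -9.2]`; not a certificate, not a prediction):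
`d ≥ 0.0145`, `k ≤ -0.8585`, `m_loc ≤ 0.8459`, `dev ≤ 5.1314`, `nInside ≥ 8.8686`
(`illustration16_four_N14_U8_of_minus_ten_le`). Informative iff `E₁₆ > u₈`; consistency clause
`E₁₆ ≤ u₈ + 128·0.0742` (else one of the two certificates is refuted, cf. row C1d).

Every certificate is an OPEN obligation BY NAME (hypothesis). No sorry. WEAK label (ED-able cluster).
-/


noncomputable section

namespace Summit.HubbardSuperconductivity.HubbardLadder

open Literature.MathematicalPhysics.QuantumLattice Literature.Probability.LatticeModels Matrix
open Literature.MathematicalPhysics.QuantumLattice.FermiSmearing DoubleOccupancy Bounds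

/-- **Double-occupancy floor from a `U′ = 16` lower bound** (`N = 14`, `U = 8`; exact-hypothesis form):
`E_14(8) ≤ u₈` and `E₁₆ ≤ E_14(16)` give `d ≥ (E₁₆ - u₈)/128`. [cite: KomaTasaki1994, §1] -/
theorem doubleOcc_four_N14_U8_ge_of_lower16 {ψ : Fock (Orb (FermionTorus 2 4))}
    (hψ : IsGroundState (hamiltonian (fermionTorusGraph 2 4) 1 8) 14 ψ) (hψ1 : star ψ ⬝ᵥ ψ = 1) {E₁₆ : ℝ}
    (hR : groundEnergyAt (fermionTorusGraph 2 4) 1 8 14 ≤ (-815606355579 : ℝ) / 2 ^ 36)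
    (hL : E₁₆ ≤ groundEnergyAt (fermionTorusGraph 2 4) 1 16 14) :
    (E₁₆ - (-815606355579 : ℝ) / 2 ^ 36) / 128 ≤
      (expect (∑ x : FermionTorus 2 4, numberOp x 0 * numberOp x 1) ψ).re / 16 := by
  have h := groundEnergyAt_sub_le_mul_doubleOcc (fermionTorusGraph 2 4) 1 8 16 hψ hψ1
  norm_num at h
  linarith

/-- **Double-occupancy floor, claim form in the `U = 8` node** (`torusUpper_mbbootE2_4x4_U8_N14`), parametric in
the `U′ = 16` lower bound `E₁₆`. [cite: KomaTasaki1994, §1] -/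
theorem doubleOcc_four_N14_U8_ge_of_claim_of_lower16 {ψ : Fock (Orb (FermionTorus 2 4))}
    (hψ : IsGroundState (hamiltonian (fermionTorusGraph 2 4) 1 8) 14 ψ) (hψ1 : star ψ ⬝ᵥ ψ = 1) {E₁₆ : ℝ}
    (h₈ : torusUpper_mbbootE2_4x4_U8_N14) (hL : E₁₆ ≤ groundEnergyAt (fermionTorusGraph 2 4) 1 16 14) :
    (E₁₆ - (-815606355579 : ℝ) / 2 ^ 36) / 128 ≤
      (expect (∑ x : FermionTorus 2 4, numberOp x 0 * numberOp x 1) ψ).re / 16 :=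
  doubleOcc_four_N14_U8_ge_of_lower16 hψ hψ1 (groundEnergyAt_4x4_U8_N14_le_of_claim h₈) hL

/-- **Kinetic-energy ceiling from a `U′ = 16` lower bound**: `k ≤ (2u₈ - E₁₆)/16`
(`K = E_14(8) - 8⟨D⟩ ≤ E_14(8) - (E_14(16) - E_14(8))`). [cite: KomaTasaki1994, §1] -/
theorem kineticPerSite_four_N14_U8_le_of_lower16 {ψ : Fock (Orb (FermionTorus 2 4))}
    (hψ : IsGroundState (hamiltonian (fermionTorusGraph 2 4) 1 8) 14 ψ) (hψ1 : star ψ ⬝ᵥ ψ = 1) {E₁₆ : ℝ}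
    (h₈ : torusUpper_mbbootE2_4x4_U8_N14) (hL : E₁₆ ≤ groundEnergyAt (fermionTorusGraph 2 4) 1 16 14) :
    (expect (hamiltonian (fermionTorusGraph 2 4) 1 0) ψ).re / 16 ≤
      (2 * ((-815606355579 : ℝ) / 2 ^ 36) - E₁₆) / 16 := by
  have hK := re_expect_kinetic_eq (fermionTorusGraph 2 4) 1 8 hψ hψ1
  have hD := groundEnergyAt_sub_le_mul_doubleOcc (fermionTorusGraph 2 4) 1 8 16 hψ hψ1
  have hE := groundEnergyAt_4x4_U8_N14_le_of_claim h₈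
  norm_num at hD
  rw [hK]
  linarith

/-- **Bond-averaged hopping amplitude from a `U′ = 16` lower bound**:
`Re(Σ_σ Σ_{x∼y} ⟨c†_{xσ}c_{yσ}⟩)/128 ∈ [-(2u₈ - E₁₆)/128, 3/16]` (upper end = the free value).
[cite: LiebLossMccann1993, Theorem eqs. (5)-(6)][cite: KomaTasaki1994, §1] -/
theorem bondAvg_four_N14_U8_mem_Icc_of_lower16 {ψ : Fock (Orb (FermionTorus 2 4))}
    (hψ : IsGroundState (hamiltonian (fermionTorusGraph 2 4) 1 8) 14 ψ) (hψ1 : star ψ ⬝ᵥ ψ = 1) {E₁₆ : ℝ}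
    (h₈ : torusUpper_mbbootE2_4x4_U8_N14) (hL : E₁₆ ≤ groundEnergyAt (fermionTorusGraph 2 4) 1 16 14) :
    (∑ x : FermionTorus 2 4, ∑ y : FermionTorus 2 4, ∑ σ : Fin 2,
        if (fermionTorusGraph 2 4).Adj x y then expect (creation (orb x σ) * annihilation (orb y σ)) ψ
        else 0).re / 128 ∈
      Set.Icc (-((2 * ((-815606355579 : ℝ) / 2 ^ 36) - E₁₆) / 16) / 8) (-(-3 / 2 : ℝ) / 8) :=
  bondAvg_four_mem_Icc_of_kinetic
    ⟨kineticPerSite_four_N14_ge_free hψ.1 hψ1, kineticPerSite_four_N14_U8_le_of_lower16 hψ hψ1 h₈ hL⟩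

/-- **Local-moment ceiling from a `U′ = 16` lower bound**: `m_loc ≤ 7/8 - (E₁₆ - u₈)/64` (`m_loc = n - 2d`).
[cite: HirschPRB1985, Table II][cite: KomaTasaki1994, §1] -/
theorem localMoment_four_N14_U8_le_of_lower16 {ψ : Fock (Orb (FermionTorus 2 4))}
    (hψ : IsGroundState (hamiltonian (fermionTorusGraph 2 4) 1 8) 14 ψ) (hψ1 : star ψ ⬝ᵥ ψ = 1) {E₁₆ : ℝ}
    (h₈ : torusUpper_mbbootE2_4x4_U8_N14) (hL : E₁₆ ≤ groundEnergyAt (fermionTorusGraph 2 4) 1 16 14) :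
    (expect localMomentFour ψ).re / 16 ≤ 7 / 8 - (E₁₆ - (-815606355579 : ℝ) / 2 ^ 36) / 64 := by
  have hd := doubleOcc_four_N14_U8_ge_of_claim_of_lower16 hψ hψ1 h₈ hL
  rw [re_expect_localMomentFour hψ.1 hψ1]
  push_cast
  linarith

/-- **Fermi-surface smearing ceiling from a `U′ = 16` lower bound** (device D24 kernel `FermiSmearing`:
`W_0 = Re⟨ψ,H₀ψ⟩ + 24`): `W_0 ≤ 2u₈ - E₁₆ + 24`. [cite: LiebLoss2001, Theorem 1.14][cite: KomaTasaki1994, §1] -/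
theorem smearing_four_N14_U8_le_of_lower16 {ψ : Fock (Orb (FermionTorus 2 4))}
    (hψ : IsGroundState (hamiltonian (fermionTorusGraph 2 4) 1 8) 14 ψ) (hψ1 : star ψ ⬝ᵥ ψ = 1) {E₁₆ : ℝ}
    (h₈ : torusUpper_mbbootE2_4x4_U8_N14) (hL : E₁₆ ≤ groundEnergyAt (fermionTorusGraph 2 4) 1 16 14) :
    smearing 0 ψ ≤ 2 * ((-815606355579 : ℝ) / 2 ^ 36) - E₁₆ + 24 := by
  have hk := kineticPerSite_four_N14_U8_le_of_lower16 hψ hψ1 h₈ hL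
  have hW := smearing_zero_four_eq hψ.1
  have hK : (expect (hamiltonian (fermionTorusGraph 2 4) 1 0) ψ).re =
      (star ψ ⬝ᵥ (hubbardTorus 2 4 1 0 *ᵥ ψ)).re := rfl
  have h1 : (star ψ ⬝ᵥ ψ).re = 1 := by rw [hψ1, Complex.one_re]
  rw [hK] at hk
  rw [hW, h1]
  linarith

/-- **Occupation rows from a `U′ = 16` lower bound** (`N = 14`, `U = 8`): with `W := 2u₈ - E₁₆ + 24`,
displaced electrons `holesBelow + nAbove ≤ W/2`, `nInside ≥ 14 - W/2`, corner pair `h_Γ + n_Q ≤ W/4`.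
[cite: LiebLoss2001, Theorem 1.14][cite: VarneyEtAl2009, §3] -/
theorem occupationRows_four_N14_U8_of_lower16 {ψ : Fock (Orb (FermionTorus 2 4))}
    (hψ : IsGroundState (hamiltonian (fermionTorusGraph 2 4) 1 8) 14 ψ) (hψ1 : star ψ ⬝ᵥ ψ = 1) {E₁₆ : ℝ}
    (h₈ : torusUpper_mbbootE2_4x4_U8_N14) (hL : E₁₆ ≤ groundEnergyAt (fermionTorusGraph 2 4) 1 16 14) :
    holesBelow ψ + nAbove ψ ≤ (2 * ((-815606355579 : ℝ) / 2 ^ 36) - E₁₆ + 24) / 2 ∧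
      14 - (2 * ((-815606355579 : ℝ) / 2 ^ 36) - E₁₆ + 24) / 2 ≤ nInside ψ ∧
      (∑ σ : Fin 2, (1 - occ 0 σ ψ)) + ∑ σ : Fin 2, occ cornerQ σ ψ ≤
        (2 * ((-815606355579 : ℝ) / 2 ^ 36) - E₁₆ + 24) / 4 := by
  have hW := smearing_four_N14_U8_le_of_lower16 hψ hψ1 h₈ hL
  have ha := two_mul_dev_le_smearing_zero ψ
  have hc := four_mul_corner_le_smearing_zero ψ
  have hd := nInside_add_nAbove hψ.1
  have he := holesBelow_nonneg ψ
  have h1 : (star ψ ⬝ᵥ ψ).re = 1 := by rw [hψ1, Complex.one_re]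
  simp only [h1] at hc hd
  push_cast at hd
  refine ⟨by linarith, by linarith, by linarith⟩

/-- **ILLUSTRATION ONLY** (hypothetical threshold, NOT a certificate and not a prediction): if some certificate
gave `-10 ≤ E_14(16)`, the rows would read `d ≥ 0.0145`, `k ≤ -0.8585`, `m_loc ≤ 0.8459`,
`holesBelow + nAbove ≤ 5.1314`, `nInside ≥ 8.8686` — the constants flow by `norm_num`. [cite: KomaTasaki1994, §1] -/
theorem illustration16_four_N14_U8_of_minus_ten_le {ψ : Fock (Orb (FermionTorus 2 4))}
    (hψ : IsGroundState (hamiltonian (fermionTorusGraph 2 4) 1 8) 14 ψ) (hψ1 : star ψ ⬝ᵥ ψ = 1)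
    (h₈ : torusUpper_mbbootE2_4x4_U8_N14) (hL : (-10 : ℝ) ≤ groundEnergyAt (fermionTorusGraph 2 4) 1 16 14) :
    (0.0145 : ℝ) ≤ (expect (∑ x : FermionTorus 2 4, numberOp x 0 * numberOp x 1) ψ).re / 16 ∧
      (expect (hamiltonian (fermionTorusGraph 2 4) 1 0) ψ).re / 16 ≤ -0.8585 ∧
      (expect localMomentFour ψ).re / 16 ≤ 0.8459 ∧
      holesBelow ψ + nAbove ψ ≤ 5.1314 ∧ (8.8686 : ℝ) ≤ nInside ψ := by
  have hd := doubleOcc_four_N14_U8_ge_of_claim_of_lower16 hψ hψ1 h₈ hL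
  have hk := kineticPerSite_four_N14_U8_le_of_lower16 hψ hψ1 h₈ hL
  have hm := localMoment_four_N14_U8_le_of_lower16 hψ hψ1 h₈ hL
  have ho := occupationRows_four_N14_U8_of_lower16 hψ hψ1 h₈ hL
  norm_num at hd hk hm ho
  refine ⟨le_trans (by norm_num) hd, le_trans hk (by norm_num), le_trans hm (by norm_num),
    le_trans ho.1 (by norm_num), le_trans (by norm_num) ho.2.1⟩

end Summit.HubbardSuperconductivity.HubbardLadder

end
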